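import Literature.AlgebraicTopology.SingularHomology.SingularChainsConcrete
import Literature.AlgebraicTopology.SingularHomology.BarycentricSubdivision
import Mathlib.Topology.MetricSpace.Pseudo.Lemmas
import Mathlib.Analysis.SpecificLimits.Basic
import HarnessLib

/-!
# Barycentric subdivision of singular chains (Hatcher Prop. 2.21, chain level)

A. Hatcher, *Algebraic Topology*, CUP 2002, §2.1, proof of Prop. 2.21, steps (3) "barycentric
subdivision of general chains" and (4) "iterated barycentric subdivision", pp. 122–123.

On the concrete singular chains `Literature.CChain M X n = (SingularSimplex X n →₀ M)` of
`Literature.AlgebraicTopology.SingularHomology.SingularChainsConcrete` we define Hatcher's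
operators and prove their identities, all sorry-free:

* affine simplices of the standard simplex `Δⁿ = Literature.StdSimplex n`: `StdSimplex.affComb`,
  `affMap` (`[w₀, …, wₖ] : Δᵏ → Δⁿ`), their composition law, `stdSimplex.map = [e_{f j}]`, and
  preservation of barycentres; `SingularSimplex.compose σ w = σ ∘ [w]` with its faces;
* `Literature.realize R M σ k`: `σ♯` from tuple chains of `Δⁿ` (file `BarycentricSubdivision`) to
  `Cₖ(X; M)`, commuting with `∂` (`bd_realize`) and natural in affine maps (`realize_push`);
* `Literature.sdX R M n = S` and `Literature.sdhX R M n = T` with **`∂ S = S ∂`** (`bd_sdX`),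
  **`∂ T + T ∂ = 𝟙 - S`** (`bd_sdhX_add_sdhX_bd`, `bd_sdhX_zero`, `sdX_zero`), both preserving the
  subcomplexes `chainsIn A` (`sdX_mem_chainsIn`, `sdhX_mem_chainsIn`);
* iterates: `Dⱼ = ∑_{i<j} T Sⁱ = Literature.sdhSum R M j n` with `∂ Dⱼ + Dⱼ ∂ = 𝟙 - Sʲ`
  (`bd_sdhSum_add_sdhSum_bd`, `bd_sdhSum_zero`);
* smallness (`exists_sdX_pow_mem_iSup`): if the image of `σ` is covered by an open family `U`, then
  some `Sʲ (m • σ)` lies in `⨆ᵢ chainsIn (U i)` — Lebesgue number of `σ⁻¹ U` on the compact metric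
  space `Δⁿ` plus the bound `diam ≤ (n/(n+1))ʲ · diam Δⁿ` from `BarycentricSubdivision`.

The homological consequence (Prop. 2.21: `C^𝒰(X) ↪ C(X)` induces isomorphisms on homology,
excision, Mayer–Vietoris) is derived from these in a separate file. [folklore]

## References

* A. Hatcher, *Algebraic Topology*, CUP 2002, §2.1, Prop. 2.21 and its proof, pp. 119–124.
-/

noncomputable section


open CategoryTheory Metric

universe u v

namespace Literature.AlgebraicTopology.SingularHomology

/-! ### Affine simplices in the standard simplex -/

/-- The standard `n`-simplex `Δⁿ ⊆ ℝⁿ⁺¹` as a type (the vertex/parameter space of singular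
simplices, `SingularSimplex.toContinuousMap : SingularSimplex X n ≃ C(Δⁿ, X)`). [folklore] -/
abbrev StdSimplex (n : ℕ) : Type := stdSimplex ℝ (Fin (n + 1))

namespace StdSimplex

variable {a b c : ℕ}

/-- The affine combination `∑ⱼ tⱼ wⱼ ∈ Δᵇ` of points `w₀, …, wₐ ∈ Δᵇ` with weights `t ∈ Δᵃ`
(Hatcher 2002, §2.1: the linear simplex `[w₀, …, wₐ]` as a map `Δᵃ → Δᵇ`). [folklore] -/
def affComb (w : Fin (a + 1) → StdSimplex b) (t : StdSimplex a) : StdSimplex b :=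
  ⟨∑ j, t j • (w j : Fin (b + 1) → ℝ),
    (convex_stdSimplex ℝ (Fin (b + 1))).sum_mem (fun j _ => t.2.1 j) t.2.2 fun j _ => (w j).2⟩

/-- Coordinates of an affine combination. [folklore] -/
@[simp]
lemma coe_affComb (w : Fin (a + 1) → StdSimplex b) (t : StdSimplex a) :
    ((affComb w t : StdSimplex b) : Fin (b + 1) → ℝ) = ∑ j, t j • (w j : Fin (b + 1) → ℝ) := rfl

/-- The affine combination map `Δᵃ → Δᵇ` is continuous. [folklore] -/
lemma continuous_affComb (w : Fin (a + 1) → StdSimplex b) : Continuous (affComb w) := by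
  refine Continuous.subtype_mk (continuous_finsetSum _ fun j _ => ?_) _
  exact ((continuous_apply j).comp continuous_subtype_val).smul continuous_const

/-- The affine simplex `[w₀, …, wₐ] : Δᵃ → Δᵇ` as a continuous map (Hatcher 2002, §2.1). [folklore] -/
def affMap (w : Fin (a + 1) → StdSimplex b) : C(StdSimplex a, StdSimplex b) :=
  ⟨affComb w, continuous_affComb w⟩

/-- `affMap w` is `affComb w` as a function. [folklore] -/
@[simp]
lemma affMap_apply (w : Fin (a + 1) → StdSimplex b) (t : StdSimplex a) : affMap w t = affComb w t :=
  rfl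

/-- The vertices `e₀, …, eₙ` of `Δⁿ` as a tuple. [folklore] -/
def vertexTuple (n : ℕ) : Fin (n + 1) → StdSimplex n := fun j => stdSimplex.vertex j

/-- A point of `Δⁿ` is the affine combination of the vertices with its own coordinates as weights:
`t = ∑ⱼ tⱼ eⱼ`. [folklore] -/
lemma affComb_vertexTuple (t : StdSimplex a) : affComb (vertexTuple a) t = t := by
  ext j
  simp only [coe_affComb, vertexTuple, stdSimplex.vertex_coe, Finset.sum_apply, Pi.smul_apply,
    Pi.single_apply, smul_eq_mul, mul_ite, mul_one, mul_zero, Finset.sum_ite_eq,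
    Finset.mem_univ, if_true]

/-- `[e₀, …, eₙ] = 𝟙 : Δⁿ → Δⁿ`. [folklore] -/
lemma affMap_vertexTuple (a : ℕ) : affMap (vertexTuple a) = ContinuousMap.id (StdSimplex a) := by
  ext t : 1
  exact affComb_vertexTuple t

/-- An affine simplex sends the vertex `eⱼ` to `wⱼ`. [folklore] -/
lemma affComb_vertex (w : Fin (a + 1) → StdSimplex b) (j : Fin (a + 1)) :
    affComb w (stdSimplex.vertex j) = w j := by
  ext i
  simp only [coe_affComb, stdSimplex.vertex_coe, Finset.sum_apply, Pi.smul_apply, Pi.single_apply,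
    smul_eq_mul, ite_mul, one_mul, zero_mul, Finset.sum_ite_eq', Finset.mem_univ, if_true]

/-- Affine combinations compose: `[w] ∘ [u] = [[w] u₀, …, [w] u_c]` (Hatcher 2002, §2.1:
composites of linear maps of simplices are linear). [folklore] -/
lemma affComb_affComb (w : Fin (a + 1) → StdSimplex b) (u : Fin (c + 1) → StdSimplex a)
    (t : StdSimplex c) : affComb w (affComb u t) = affComb (fun j => affComb w (u j)) t := by
  ext i
  simp only [coe_affComb, Finset.sum_apply, Pi.smul_apply, smul_eq_mul, Finset.mul_sum,
    Finset.sum_mul]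
  rw [Finset.sum_comm]
  refine Finset.sum_congr rfl fun j _ => Finset.sum_congr rfl fun l _ => ?_
  ring

/-- `affMap w ∘ affMap u = affMap ([w] ∘ u)`. [folklore] -/
lemma affMap_comp_affMap (w : Fin (a + 1) → StdSimplex b) (u : Fin (c + 1) → StdSimplex a) :
    (affMap w).comp (affMap u) = affMap (fun j => affComb w (u j)) := by
  ext t : 1
  exact affComb_affComb w u t

/-- The maps `stdSimplex.map f : Δᵃ → Δᵇ` of the cosimplicial structure are the affine simplices on
the vertices `e_{f 0}, …, e_{f a}`. [folklore] -/
lemma stdSimplex_map_eq_affComb (f : Fin (a + 1) → Fin (b + 1)) (t : StdSimplex a) :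
    stdSimplex.map f t = affComb (fun j => stdSimplex.vertex (f j)) t := by
  ext i
  simp only [stdSimplex.map_coe, coe_affComb, stdSimplex.vertex_coe, Finset.sum_apply,
    Pi.smul_apply, Pi.single_apply, smul_eq_mul, mul_ite, mul_one, mul_zero]
  rw [FunOnFinite.linearMap_apply_apply, Finset.sum_filter]
  refine Finset.sum_congr rfl fun j _ => ?_
  rcases eq_or_ne (f j) i with h | h
  · simp [h]
  · simp [h, Ne.symm h]

/-- The barycentre of a tuple of points of `Δⁿ` (Hatcher 2002, §2.1). [folklore] -/
abbrev sbary (n k : ℕ) (w : Fin (k + 1) → StdSimplex n) : StdSimplex n :=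
  TupleChain.baryOf (convex_stdSimplex ℝ (Fin (n + 1))) k w

/-- Coordinates of the barycentre: `(b_w)ᵢ = ∑ⱼ (k+1)⁻¹ (wⱼ)ᵢ`. [folklore] -/
lemma sbary_apply (n k : ℕ) (w : Fin (k + 1) → StdSimplex n) (i : Fin (n + 1)) :
    sbary n k w i = ∑ j, ((k : ℝ) + 1)⁻¹ * w j i := by
  change (TupleChain.baryOf _ k w).1 i = _
  rw [TupleChain.coe_baryOf, Finset.sum_apply]
  rfl

/-- Coordinates of an affine combination: `([w] t)ᵢ = ∑ⱼ tⱼ (wⱼ)ᵢ`. [folklore] -/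
lemma affComb_apply (w : Fin (a + 1) → StdSimplex b) (t : StdSimplex a) (i : Fin (b + 1)) :
    affComb w t i = ∑ j, t j * w j i := by
  rw [coe_affComb, Finset.sum_apply]
  rfl

/-- Affine simplices preserve barycentres: `[w] (b_v) = b_{[w] ∘ v}`. [folklore] -/
lemma affComb_sbary (w : Fin (a + 1) → StdSimplex b) (k : ℕ) (v : Fin (k + 1) → StdSimplex a) :
    affComb w (sbary a k v) = sbary b k (fun j => affComb w (v j)) := by
  ext i
  simp only [affComb_apply, sbary_apply, Finset.mul_sum, Finset.sum_mul]
  rw [Finset.sum_comm]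
  refine Finset.sum_congr rfl fun j _ => Finset.sum_congr rfl fun l _ => ?_
  ring

end StdSimplex

/-! ### Affine singular simplices and composition with a singular simplex -/

namespace SingularSimplex

variable {X : Type u} [TopologicalSpace X] {n k l : ℕ}

/-- `σ ∘ [w₀, …, wₖ]`: the singular `k`-simplex obtained by restricting `σ : Δⁿ → X` along the
affine simplex `[w] : Δᵏ → Δⁿ` spanned by `w` (Hatcher 2002, §2.1: `σ♯` of a linear simplex, used to
define `S σ = σ♯ S Δⁿ`). [folklore] -/
def compose (σ : SingularSimplex X n) (w : Fin (k + 1) → StdSimplex n) : SingularSimplex X k :=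
  toContinuousMap.symm ((toContinuousMap σ).comp (StdSimplex.affMap w))

/-- The continuous map of `σ ∘ [w]`. [folklore] -/
@[simp]
lemma toContinuousMap_compose (σ : SingularSimplex X n) (w : Fin (k + 1) → StdSimplex n) :
    toContinuousMap (σ.compose w) = (toContinuousMap σ).comp (StdSimplex.affMap w) :=
  Equiv.apply_symm_apply _ _

/-- Faces of `σ ∘ [w]` are `σ ∘ [w ∘ δᵢ]` (Hatcher 2002, §2.1: `∂` of a linear simplex). [folklore] -/
lemma compose_face (σ : SingularSimplex X n) (w : Fin (k + 2) → StdSimplex n) (i : Fin (k + 2)) :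
    (σ.compose w).face i = σ.compose (w ∘ Fin.succAbove i) := by
  apply toContinuousMap_injective
  rw [toContinuousMap_face, toContinuousMap_compose, toContinuousMap_compose,
    ContinuousMap.comp_assoc]
  congr 1
  ext t : 1
  change StdSimplex.affComb w (stdSimplex.map (Fin.succAbove i) t) = StdSimplex.affComb _ t
  rw [StdSimplex.stdSimplex_map_eq_affComb, StdSimplex.affComb_affComb]
  congr 1
  ext j : 1
  exact StdSimplex.affComb_vertex w _

/-- `σ ∘ [e₀, …, eₙ] = σ`. [folklore] -/
lemma compose_vertexTuple (σ : SingularSimplex X n) :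
    σ.compose (StdSimplex.vertexTuple n) = σ := by
  apply toContinuousMap_injective
  rw [toContinuousMap_compose, StdSimplex.affMap_vertexTuple, ContinuousMap.comp_id]

/-- `(σ ∘ [w]) ∘ [u] = σ ∘ [[w] u₀, …, [w] uₗ]`. [folklore] -/
lemma compose_compose (σ : SingularSimplex X n) (w : Fin (k + 1) → StdSimplex n)
    (u : Fin (l + 1) → StdSimplex k) :
    (σ.compose w).compose u = σ.compose (fun j => StdSimplex.affComb w (u j)) := by
  apply toContinuousMap_injective
  rw [toContinuousMap_compose, toContinuousMap_compose, toContinuousMap_compose,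
    ContinuousMap.comp_assoc, StdSimplex.affMap_comp_affMap]

/-- The faces of `σ` are the composites with the affine faces of `Δⁿ`:
`σ ∘ δᵢ = σ ∘ [e_{δᵢ 0}, …, e_{δᵢ n}]`. [folklore] -/
lemma face_eq_compose (σ : SingularSimplex X (n + 1)) (i : Fin (n + 2)) :
    σ.face i = σ.compose (fun j => stdSimplex.vertex (Fin.succAbove i j)) := by
  apply toContinuousMap_injective
  rw [toContinuousMap_face, toContinuousMap_compose]
  congr 1
  ext t : 1
  exact StdSimplex.stdSimplex_map_eq_affComb _ t

/-- The image of `σ ∘ [w]` is the image under `σ` of the affine simplex `[w]`. [folklore] -/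
lemma range_compose (σ : SingularSimplex X n) (w : Fin (k + 1) → StdSimplex n) :
    (σ.compose w).range = toContinuousMap σ '' Set.range (StdSimplex.affMap w) := by
  rw [range, toContinuousMap_compose, ContinuousMap.coe_comp, Set.range_comp]

/-- The image of `σ ∘ [w]` is contained in the image of `σ`. [folklore] -/
lemma range_compose_subset (σ : SingularSimplex X n) (w : Fin (k + 1) → StdSimplex n) :
    (σ.compose w).range ⊆ σ.range := by
  rw [range_compose]
  exact Set.image_subset_range _ _

end SingularSimplex

/-! ### Realizing tuple chains of `Δⁿ` as singular chains -/

section Realize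

variable (R : Type v) [CommRing R] (M : Type v) [AddCommGroup M] [Module R M]
variable {X : Type u} [TopologicalSpace X] {n k l : ℕ}

/-- Realization of tuple chains of `Δⁿ` against a singular `n`-simplex `σ` of `X`:
`[w] ↦ (m ↦ m • (σ ∘ [w]))`, extended `ℤ`-linearly (Hatcher 2002, §2.1: `σ♯` applied to a linear
chain of `Δⁿ`). [folklore] -/
def realize (σ : SingularSimplex X n) (k : ℕ) :
    TupleChain (StdSimplex n) k →ₗ[ℤ] (M →ₗ[R] CChain M X k) :=
  Finsupp.lsum ℤ fun w => (LinearMap.id : ℤ →ₗ[ℤ] ℤ).smulRight (Finsupp.lsingle (σ.compose w))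

variable {R M}

/-- Realization of an elementary tuple chain. [folklore] -/
lemma realize_single (σ : SingularSimplex X n) (w : Fin (k + 1) → StdSimplex n) (z : ℤ) (m : M) :
    realize R M σ k (Finsupp.single w z) m = z • Finsupp.single (σ.compose w) m := by
  simp [realize]

/-- The signs `(-1)ⁱ` of the singular boundary as integer scalars. [folklore] -/
lemma neg_one_pow_smul_eq_zsmul (i : ℕ) (c : CChain M X k) :
    ((-1 : R) ^ i) • c = ((-1 : ℤ) ^ i) • c := by
  rw [← Int.cast_smul_eq_zsmul R, Int.cast_pow, Int.cast_neg, Int.cast_one]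

/-- Realization commutes with boundaries: `∂ (σ♯ c) = σ♯ (∂ c)` (Hatcher 2002, §2.1). [folklore] -/
lemma bd_realize (σ : SingularSimplex X n) (c : TupleChain (StdSimplex n) (k + 1)) (m : M) :
    csingularChainComplex.bd R k (realize R M σ (k + 1) c m) =
      realize R M σ k (TupleChain.bd k c) m := by
  induction c using Finsupp.induction_linear with
  | zero => simp
  | add x y hx hy => simp only [map_add, LinearMap.add_apply, hx, hy]
  | single w z =>
    rw [realize_single, map_zsmul, csingularChainComplex.bd_single, TupleChain.bd_single, map_sum,
      LinearMap.sum_apply, Finset.smul_sum]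
    refine Finset.sum_congr rfl fun i _ => ?_
    rw [map_zsmul, LinearMap.smul_apply, realize_single, SingularSimplex.compose_face,
      neg_one_pow_smul_eq_zsmul, smul_comm]

/-- Realization of the identity linear simplex `[e₀, …, eₙ]` gives back `σ`. [folklore] -/
lemma realize_vertexTuple (σ : SingularSimplex X n) (m : M) :
    realize R M σ n (Finsupp.single (StdSimplex.vertexTuple n) 1) m = Finsupp.single σ m := by
  rw [realize_single, one_smul, SingularSimplex.compose_vertexTuple]

/-- Realizing a pushed-forward chain along an affine simplex `[w]` is realizing against `σ ∘ [w]`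
(Hatcher 2002, §2.1, naturality of `σ♯`). [folklore] -/
lemma realize_push (σ : SingularSimplex X n) (w : Fin (k + 1) → StdSimplex n)
    (c : TupleChain (StdSimplex k) l) (m : M) :
    realize R M σ l (TupleChain.push (StdSimplex.affComb w) l c) m = realize R M (σ.compose w) l c m := by
  induction c using Finsupp.induction_linear with
  | zero => simp
  | add x y hx hy => simp only [map_add, LinearMap.add_apply, hx, hy]
  | single u z =>
    rw [TupleChain.push_single, realize_single, realize_single, SingularSimplex.compose_compose]
    rfl

/-- Realized chains are supported in the image of `σ` (Hatcher 2002, §2.1: `S` and `T` preserve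
`Cₙ(A)`). [folklore] -/
lemma realize_mem_chainsIn (σ : SingularSimplex X n) (c : TupleChain (StdSimplex n) k) (m : M) :
    realize R M σ k c m ∈ chainsIn R M X σ.range k := by
  induction c using Finsupp.induction_linear with
  | zero => simp
  | add x y hx hy =>
    rw [map_add, LinearMap.add_apply]
    exact Submodule.add_mem _ hx hy
  | single w z =>
    rw [realize_single]
    exact zsmul_mem (single_mem_chainsIn R M (SingularSimplex.range_compose_subset σ w) m) z

end Realize

/-! ### The subdivision operator `S` and the operator `T` on singular chains -/

section Operators

variable (R : Type v) [CommRing R] (M : Type v) [AddCommGroup M] [Module R M]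
variable {X : Type u} [TopologicalSpace X] {n k : ℕ}

/-- The barycentric subdivision `S Δⁿ` of the identity linear simplex of `Δⁿ`, as a tuple chain
(Hatcher 2002, §2.1, "barycentric subdivision of linear chains"). [folklore] -/
def sdTuple (n : ℕ) : TupleChain (StdSimplex n) n :=
  TupleChain.sd (StdSimplex.sbary n) n (Finsupp.single (StdSimplex.vertexTuple n) 1)

/-- `T Δⁿ` for the identity linear simplex of `Δⁿ`, as a tuple chain (Hatcher 2002, §2.1). [folklore] -/
def sdhTuple (n : ℕ) : TupleChain (StdSimplex n) (n + 1) :=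
  TupleChain.sdh (StdSimplex.sbary n) n (Finsupp.single (StdSimplex.vertexTuple n) 1)

/-- **The subdivision operator** `S : Cₙ(X; M) → Cₙ(X; M)`, `S σ = σ♯ (S Δⁿ)`
(Hatcher 2002, §2.1, "barycentric subdivision of general chains", p. 122). [folklore] -/
def sdX (n : ℕ) : CChain M X n →ₗ[R] CChain M X n :=
  Finsupp.lsum R fun σ => realize R M σ n (sdTuple n)

/-- The operator `T : Cₙ(X; M) → Cₙ₊₁(X; M)`, `T σ = σ♯ (T Δⁿ)`, a chain homotopy between `𝟙` and
`S` (Hatcher 2002, §2.1, p. 122). [folklore] -/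
def sdhX (n : ℕ) : CChain M X n →ₗ[R] CChain M X (n + 1) :=
  Finsupp.lsum R fun σ => realize R M σ (n + 1) (sdhTuple n)

variable {R M}

/-- `S` on an elementary chain. [folklore] -/
lemma sdX_single (σ : SingularSimplex X n) (m : M) :
    sdX R M n (Finsupp.single σ m) = realize R M σ n (sdTuple n) m := by
  simp [sdX]

/-- `T` on an elementary chain. [folklore] -/
lemma sdhX_single (σ : SingularSimplex X n) (m : M) :
    sdhX R M n (Finsupp.single σ m) = realize R M σ (n + 1) (sdhTuple n) m := by
  simp [sdhX]

/-- `S` intertwines realization with the subdivision of tuple chains: `S (σ♯ c) = σ♯ (S c)`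
(Hatcher 2002, §2.1: naturality of `S` on linear chains under `σ♯`). [folklore] -/
lemma sdX_realize (σ : SingularSimplex X n) (c : TupleChain (StdSimplex n) k) (m : M) :
    sdX R M k (realize R M σ k c m) = realize R M σ k (TupleChain.sd (StdSimplex.sbary n) k c) m := by
  induction c using Finsupp.induction_linear with
  | zero => simp
  | add x y hx hy => simp only [map_add, LinearMap.add_apply, hx, hy]
  | single w z =>
    rw [realize_single, map_zsmul, sdX_single, sdTuple, ← realize_push,
      TupleChain.push_sd _ _ (StdSimplex.sbary n) (fun k' v => StdSimplex.affComb_sbary w k' v),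
      TupleChain.push_single,
      show StdSimplex.affComb w ∘ StdSimplex.vertexTuple k = w from
        funext fun j => StdSimplex.affComb_vertex w j,
      TupleChain.sd_single_eq_smul _ k w z, map_zsmul, LinearMap.smul_apply]

/-- `T` intertwines realization with `T` of tuple chains: `T (σ♯ c) = σ♯ (T c)` (Hatcher 2002, §2.1). [folklore] -/
lemma sdhX_realize (σ : SingularSimplex X n) (c : TupleChain (StdSimplex n) k) (m : M) :
    sdhX R M k (realize R M σ k c m) =
      realize R M σ (k + 1) (TupleChain.sdh (StdSimplex.sbary n) k c) m := by
  induction c using Finsupp.induction_linear with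
  | zero => simp
  | add x y hx hy => simp only [map_add, LinearMap.add_apply, hx, hy]
  | single w z =>
    rw [realize_single, map_zsmul, sdhX_single, sdhTuple, ← realize_push,
      TupleChain.push_sdh _ _ (StdSimplex.sbary n) (fun k' v => StdSimplex.affComb_sbary w k' v),
      TupleChain.push_single,
      show StdSimplex.affComb w ∘ StdSimplex.vertexTuple k = w from
        funext fun j => StdSimplex.affComb_vertex w j,
      ← Finsupp.smul_single_one w z, map_zsmul, map_zsmul, LinearMap.smul_apply]

/-- **`S` is a chain map**: `∂ S = S ∂` (Hatcher 2002, §2.1, p. 122). [folklore] -/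
theorem bd_sdX (c : CChain M X (n + 1)) :
    csingularChainComplex.bd R n (sdX R M (n + 1) c) = sdX R M n (csingularChainComplex.bd R n c) := by
  induction c using Finsupp.induction_linear with
  | zero => simp
  | add x y hx hy => simp only [map_add, hx, hy]
  | single σ m =>
    rw [sdX_single, sdTuple, bd_realize, TupleChain.bd_sd, ← realize_vertexTuple (R := R) σ m,
      bd_realize, sdX_realize]

/-- `S = 𝟙` in degree `0` (Hatcher 2002, §2.1). [folklore] -/
theorem sdX_zero (c : CChain M X 0) : sdX R M 0 c = c := by
  induction c using Finsupp.induction_linear with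
  | zero => simp
  | add x y hx hy => simp only [map_add, hx, hy]
  | single σ m => rw [sdX_single, sdTuple, TupleChain.sd_zero, realize_vertexTuple]

/-- **`T` is a chain homotopy from `𝟙` to `S`**: `∂ T + T ∂ = 𝟙 - S` in positive degrees
(Hatcher 2002, §2.1, p. 122). [folklore] -/
theorem bd_sdhX_add_sdhX_bd (c : CChain M X (n + 1)) :
    csingularChainComplex.bd R (n + 1) (sdhX R M (n + 1) c) + sdhX R M n (csingularChainComplex.bd R n c) =
      c - sdX R M (n + 1) c := by
  induction c using Finsupp.induction_linear with
  | zero => simp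
  | add x y hx hy =>
    simp only [map_add] at hx hy ⊢
    rw [add_add_add_comm, hx, hy]
    abel
  | single σ m =>
    rw [sdhX_single, sdhTuple, bd_realize, ← realize_vertexTuple (R := R) σ m, bd_realize,
      sdhX_realize, sdX_realize, ← LinearMap.add_apply, ← map_add, TupleChain.bd_sdh_succ, map_sub,
      LinearMap.sub_apply]

/-- `∂ T = 0 (= 𝟙 - S)` in degree `0` (Hatcher 2002, §2.1). [folklore] -/
theorem bd_sdhX_zero (c : CChain M X 0) : csingularChainComplex.bd R 0 (sdhX R M 0 c) = 0 := by
  induction c using Finsupp.induction_linear with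
  | zero => simp
  | add x y hx hy => simp only [map_add, hx, hy, add_zero]
  | single σ m => rw [sdhX_single, sdhTuple, bd_realize, TupleChain.bd_sdh_zero, map_zero,
      LinearMap.zero_apply]

/-- `S` maps chains in `A` to chains in `A` (Hatcher 2002, §2.1: `S` takes `Cₙ(A)` to itself). [folklore] -/
theorem sdX_mem_chainsIn {A : Set X} {c : CChain M X n} (hc : c ∈ chainsIn R M X A n) :
    sdX R M n c ∈ chainsIn R M X A n := by
  rw [← Finsupp.sum_single c, Finsupp.sum, map_sum]
  refine Submodule.sum_mem _ fun σ hσ => ?_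
  rw [sdX_single]
  exact chainsIn_mono R M ((mem_chainsIn_iff R M c).mp hc σ hσ) n (realize_mem_chainsIn σ _ (c σ))

/-- `T` maps chains in `A` to chains in `A` (Hatcher 2002, §2.1). [folklore] -/
theorem sdhX_mem_chainsIn {A : Set X} {c : CChain M X n} (hc : c ∈ chainsIn R M X A n) :
    sdhX R M n c ∈ chainsIn R M X A (n + 1) := by
  rw [← Finsupp.sum_single c, Finsupp.sum, map_sum]
  refine Submodule.sum_mem _ fun σ hσ => ?_
  rw [sdhX_single]
  exact chainsIn_mono R M ((mem_chainsIn_iff R M c).mp hc σ hσ) (n + 1)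
    (realize_mem_chainsIn σ _ (c σ))

end Operators

/-! ### Iterated subdivision and the chain homotopy `Dⱼ = ∑_{i<j} T Sⁱ` -/

section Iterate

variable (R : Type v) [CommRing R] (M : Type v) [AddCommGroup M] [Module R M]
variable {X : Type u} [TopologicalSpace X] {n k : ℕ}

/-- The chain homotopy `Dⱼ = ∑_{i<j} T Sⁱ : Cₙ → Cₙ₊₁` between `𝟙` and `Sʲ`
(Hatcher 2002, §2.1, proof of Prop. 2.21: `D_m = ∑_{0≤i<m} T Sⁱ`). [folklore] -/
def sdhSum (j n : ℕ) : CChain M X n →ₗ[R] CChain M X (n + 1) :=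
  ∑ i ∈ Finset.range j, sdhX R M n ∘ₗ (sdX R M n) ^ i

variable {R M}

/-- `Sʲ` intertwines realization: `Sʲ (σ♯ c) = σ♯ (Sʲ c)`. [folklore] -/
lemma sdX_pow_realize (σ : SingularSimplex X n) (c : TupleChain (StdSimplex n) k) (m : M) (j : ℕ) :
    ((sdX R M k) ^ j) (realize R M σ k c m) =
      realize R M σ k ((TupleChain.sd (StdSimplex.sbary n) k)^[j] c) m := by
  induction j with
  | zero => simp
  | succ j ih => rw [pow_succ', Module.End.mul_apply, ih, sdX_realize, Function.iterate_succ_apply']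

/-- `Sʲ ∂ = ∂ Sʲ`. [folklore] -/
lemma sdX_pow_bd (j : ℕ) (c : CChain M X (n + 1)) :
    ((sdX R M n) ^ j) (csingularChainComplex.bd R n c) =
      csingularChainComplex.bd R n (((sdX R M (n + 1)) ^ j) c) := by
  induction j with
  | zero => simp
  | succ j ih => rw [pow_succ', Module.End.mul_apply, ih, ← bd_sdX, pow_succ', Module.End.mul_apply]

/-- `S = 𝟙` in degree `0`, iterated. [folklore] -/
lemma sdX_pow_zero_apply (j : ℕ) (c : CChain M X 0) : ((sdX R M 0) ^ j) c = c := by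
  induction j with
  | zero => simp
  | succ j ih => rw [pow_succ', Module.End.mul_apply, ih, sdX_zero]

/-- **`Dⱼ` is a chain homotopy from `𝟙` to `Sʲ`**: `∂ Dⱼ + Dⱼ ∂ = 𝟙 - Sʲ` in positive degrees
(Hatcher 2002, §2.1, proof of Prop. 2.21). [folklore] -/
theorem bd_sdhSum_add_sdhSum_bd (j : ℕ) (c : CChain M X (n + 1)) :
    csingularChainComplex.bd R (n + 1) (sdhSum R M j (n + 1) c) +
        sdhSum R M j n (csingularChainComplex.bd R n c) =
      c - ((sdX R M (n + 1)) ^ j) c := by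
  induction j with
  | zero => simp [sdhSum]
  | succ j ih =>
    simp only [sdhSum, Finset.sum_range_succ, LinearMap.add_apply, LinearMap.comp_apply,
      map_add] at ih ⊢
    rw [add_add_add_comm, ih, sdX_pow_bd, bd_sdhX_add_sdhX_bd, pow_succ', Module.End.mul_apply]
    abel

/-- `∂ Dⱼ = 0 (= 𝟙 - Sʲ)` in degree `0`. [folklore] -/
theorem bd_sdhSum_zero (j : ℕ) (c : CChain M X 0) :
    csingularChainComplex.bd R 0 (sdhSum R M j 0 c) = 0 := by
  simp only [sdhSum, LinearMap.sum_apply, LinearMap.comp_apply, map_sum]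
  exact Finset.sum_eq_zero fun i _ => bd_sdhX_zero _

/-- `Sʲ` maps chains in `A` to chains in `A`. [folklore] -/
theorem sdX_pow_mem_chainsIn {A : Set X} (j : ℕ) {c : CChain M X n} (hc : c ∈ chainsIn R M X A n) :
    ((sdX R M n) ^ j) c ∈ chainsIn R M X A n := by
  induction j with
  | zero => simpa using hc
  | succ j ih => rw [pow_succ', Module.End.mul_apply]; exact sdX_mem_chainsIn ih

/-- `Dⱼ` maps chains in `A` to chains in `A`. [folklore] -/
theorem sdhSum_mem_chainsIn {A : Set X} (j : ℕ) {c : CChain M X n} (hc : c ∈ chainsIn R M X A n) :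
    sdhSum R M j n c ∈ chainsIn R M X A (n + 1) := by
  simp only [sdhSum, LinearMap.sum_apply, LinearMap.comp_apply]
  exact Submodule.sum_mem _ fun i _ => sdhX_mem_chainsIn (sdX_pow_mem_chainsIn i hc)

end Iterate

/-! ### Iterated subdivisions of a simplex become `𝒰`-small (Lebesgue number argument) -/

section Small

variable (R : Type v) [CommRing R] (M : Type v) [AddCommGroup M] [Module R M]
variable {X : Type u} [TopologicalSpace X] {n k : ℕ}

variable {R M} in
/-- A realized chain lies in a submodule as soon as all its elementary pieces do. [folklore] -/
lemma realize_mem_of_forall {σ : SingularSimplex X n} {c : TupleChain (StdSimplex n) k} {m : M}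
    (N : Submodule R (CChain M X k))
    (h : ∀ w ∈ c.support, Finsupp.single (σ.compose w) m ∈ N) : realize R M σ k c m ∈ N := by
  rw [← Finsupp.sum_single c, Finsupp.sum, map_sum, LinearMap.sum_apply]
  refine Submodule.sum_mem _ fun w hw => ?_
  rw [realize_single]
  exact zsmul_mem (h w hw) _

/-- The affine simplex `[w]` lies within the diameter of its vertex set from `w₀`. [folklore] -/
lemma dist_affComb_zero_le (w : Fin (k + 1) → StdSimplex n) (t : StdSimplex k) :
    dist (StdSimplex.affComb w t) (w 0) ≤ diam (TupleChain.vrange w) := by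
  rw [Subtype.dist_eq]
  exact TupleChain.dist_affineCombination_le w t 0

/-- **Iterated subdivision makes a simplex small** (Hatcher 2002, §2.1, proof of Prop. 2.21, via the
Lebesgue number of the cover `σ⁻¹(𝒰)` of the compact metric space `Δⁿ` and the diameter bound
`(n/(n+1))ʲ → 0`): for an open family `U` covering the image of `σ`, some `Sʲ (m • σ)` is a sum of
chains each supported in a single `U i`. [folklore] -/
theorem exists_sdX_pow_mem_iSup {ι : Type*} (U : ι → Set X) (hU : ∀ i, IsOpen (U i))
    (σ : SingularSimplex X n) (hσ : σ.range ⊆ ⋃ i, U i) (m : M) :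
    ∃ j : ℕ, ((sdX R M n) ^ j) (Finsupp.single σ m) ∈ ⨆ i, chainsIn R M X (U i) n := by
  -- the open cover of `Δⁿ` pulled back along `σ`, and a Lebesgue number for it
  have hcover : (Set.univ : Set (StdSimplex n)) ⊆ ⋃ i, SingularSimplex.toContinuousMap σ ⁻¹' U i := by
    intro t _
    have ht : SingularSimplex.toContinuousMap σ t ∈ σ.range := ⟨t, rfl⟩
    simpa only [Set.mem_iUnion, Set.mem_preimage] using Set.mem_iUnion.mp (hσ ht)
  obtain ⟨δ, hδ, hleb⟩ := lebesgue_number_lemma_of_metric isCompact_univ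
    (fun i => (hU i).preimage (SingularSimplex.toContinuousMap σ).continuous) hcover
  -- choose `j` with `(n/(n+1))ʲ · diam Δⁿ < δ`
  set r : ℝ := (n : ℝ) / ((n : ℝ) + 1) with hr
  have hr0 : 0 ≤ r := by positivity
  have hr1 : r < 1 := by rw [hr, div_lt_one (by positivity)]; linarith
  set d₀ : ℝ := diam (TupleChain.vrange (StdSimplex.vertexTuple n)) with hd₀
  have hlim : Filter.Tendsto (fun j : ℕ => r ^ j * d₀) Filter.atTop (nhds 0) := by
    simpa using (tendsto_pow_atTop_nhds_zero_of_lt_one hr0 hr1).mul_const d₀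
  obtain ⟨j, hj⟩ := (hlim.eventually (gt_mem_nhds hδ)).exists
  refine ⟨j, ?_⟩
  rw [← realize_vertexTuple (R := R) σ m, sdX_pow_realize]
  refine realize_mem_of_forall _ fun w hw => ?_
  -- `w` is a tuple of `Sʲ Δⁿ`: small diameter, hence inside some `σ⁻¹(U i)`
  have hdiam : diam (TupleChain.vrange w) < δ := by
    refine lt_of_le_of_lt (TupleChain.diam_sd_iterate_le _ j ?_ w hw) hj
    intro w' hw'
    rw [Finset.mem_singleton.mp (Finsupp.support_single_subset hw')]
  obtain ⟨i, hi⟩ := hleb (w 0) (Set.mem_univ _)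
  refine Submodule.mem_iSup_of_mem i (single_mem_chainsIn R M ?_ m)
  rw [SingularSimplex.range_compose]
  rintro _ ⟨_, ⟨t, rfl⟩, rfl⟩
  exact hi (mem_ball.mpr (lt_of_le_of_lt (dist_affComb_zero_le w t) hdiam))

end Small

end Literature.AlgebraicTopology.SingularHomology

end
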